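import Literature.NumberTheory.EllipticCurves.TateModuleDeterminantProofs
import Literature.NumberTheory.EllipticCurves.TateModuleContinuityProofs
import Literature.NumberTheory.EllipticCurves.WeilPairingProofs
import Literature.NumberTheory.EllipticCurves.BSDSelmerPConverseSerreProofs
import Literature.NumberTheory.GaloisRepresentations.AbsGaloisGroupCompact
import HarnessLib

/-!
# Hypothesis (im) holds on the `p`-adic Tate module when `ρ̄_{E,p^n}` is onto for every `n`
# (in particular when `ρ̄_{E,p}` is onto and `p ≥ 5`, Serre)

Topic `NumberTheory/EllipticCurves`; theorems only (nothing is defined, no named fact).  Positive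
twin of `TateModuleTransvectionCriterionProofs` (which proves that (im) FAILS at an irreducible,
non-surjective prime).  The hypothesis is

> (im) there exists an element `σ ∈ G_{ℚ(μ_{p^∞})}` such that `T/(σ - 1)T ≃ ℤ_p`

of Burungale–Castella–Skinner, *Base change and Iwasawa Main Conjectures for GL₂*, IMRN 2025
(rnaf082) = arXiv:2405.00270v2, p. 2 (hypothesis of Thm. 1.1.2 (b) and Cor. 1.3.1) = Kato,
*Astérisque* 295 (2004), Thm. 13.4 (3) / 17.4 = Skinner, Pacific J. Math. 283 (2016), §2.5 (b);
BCS Rem. 1.1.3 (i): "For non-CM curves the condition (im) holds for all sufficiently large primes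
`p` by Serre's open image theorem [Ser72]".  The printed mechanism (Skinner 2016 §2.5: Kato's
hypothesis "the image of `ρ_f` contains `SL₂(ℤ_p)`" may be replaced by (a) + (b) = (im)) is: if the
image of `ρ_{E,p^∞} : Γ_ℚ → GL₂(ℤ_p)` is all of `GL₂(ℤ_p)`, the element `σ` with
`ρ(σ) = (1 1; 0 1)` has determinant `1 = χ_p(σ)`, so fixes `μ_{p^∞}`, and `T/(σ-1)T ≅ ℤ_p`.

**Theorems.**

* `WeierstrassCurve.exists_quotient_range_galoisRepTate_sub_one_equiv_of_forall_surjective`: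
  for an elliptic curve `E = W/ℚ` and a prime `p`, if `ρ̄_{E,p^n} : Γ_ℚ → Aut(E[p^n])` is onto for
  every `n` (the tree's spelling of "`ρ_{E,p^∞}` is onto `GL₂(ℤ_p)`", bsd.S20/S25), then there is
  `σ ∈ Γ_ℚ` fixing every `p`-power root of unity of `ℚ̄` with `T_pE/(σ - 1)T_pE ≃ ℤ_p`.
* `WeierstrassCurve.exists_quotient_range_galoisRepTate_sub_one_equiv_of_surjective` (`p ≥ 5`):
  the same from surjectivity of `ρ̄_{E,p}` alone, by Serre's lifting lemma — a TREE THEOREM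
  (`serre_hasSurjectiveModNGaloisRep_pow_holds`, `BSDSelmerPConverseSerreProofs`; Serre,
  *Abelian ℓ-adic representations* (1968), IV-23, §3.4 Lemma 3).

**Proof** (levelwise; no `p`-adic image group is formed).  Let `b = (b₀, b₁)` be a `ℤ_p`-basis
of `T = T_pE` (`module_free_tateModule_holds`, `finrank_tateModule_eq_two_holds`) and
`U = 1 + N`, `N t = b₁^*(t) • b₀` (so `U b₀ = b₀`, `U b₁ = b₀ + b₁`, `N² = 0`, `U⁻¹ = 1 - N`).
(1) `ker (π_n : T → E[p^n]) = p^n T` (induction on `n` from `TateModule.p_smul_div`; the same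
lemma as `TateModule.exists_eq_pow_smul_of_proj_eq_zero` of `KatzLatticeRationalTorsionProofs`) and `π_n`
is onto (`proj_surjective_of_isAlgClosed_holds`), so `U` descends to an automorphism `φ_n` of
`E[p^n]` with `φ_n (π_n t) = π_n (U t)`.  (2) By hypothesis some `σ_n ∈ Γ_ℚ` acts on `E[p^n]` as
`φ_n`; the sets `S_n = {σ | ∀ t, σ • π_n t = π_n (U t)}` are closed (`E(ℚ̄)` is a discrete
`Γ_ℚ`-module, `continuousSMul_geomPoints'`), non-empty and decreasing (`π_n = p ∘ π_{n+1}`), and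
`Γ_ℚ` is compact (`Field.absoluteGaloisGroup.instCompactSpace`), so some `σ` lies in every `S_n`,
i.e. `ρ_T(σ) = U` (`TateModule.ext`).  (3) `det U = 1` (matrix `(1 1; 0 1)` in the basis `b`), and
`det ρ_T(σ) = χ_p(σ)` (`det_galoisRepTate_eq_cyclotomicCharacter`, Weil pairing
`exists_weilPairing_holds`), so `χ_p(σ) = 1` and `σ` fixes every `p`-power root of unity
(`GaloisRep.cyclotomicCharacter_spec`).  (4) `(U - 1)T = N T = ℤ_p b₀ = ker b₁^*` and `b₁^*` is
onto, so `T/(U-1)T ≃ ℤ_p` (`LinearMap.quotKerEquivOfSurjective`).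

## References

* [BurungaleCastellaSkinner2025] A. Burungale, F. Castella, C. Skinner, IMRN 2025 (rnaf082) =
  arXiv:2405.00270v2, p. 2: hypothesis (im) and Rem. 1.1.3 (i).
* [Skinner2016PacificMC] C. Skinner, Pacific J. Math. 283 (2016), §2.5, hypotheses (*), (a), (b).
* [SerreAbelianLadic1968] J.-P. Serre, *Abelian ℓ-adic representations and elliptic curves*
  (1968), Ch. IV §3.4 Lemma 3 (IV-23) and exercise 3 (IV-27).
* [SilvermanAEC2009] J. H. Silverman, *AEC*, III.§7 (`T_ℓ E ≅ ℤ_ℓ²`), III.§8 (`det ρ_ℓ = χ_ℓ`).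
-/

noncomputable section

open scoped Classical
open Field

namespace Literature.NumberTheory.EllipticCurves.TateModule

variable {A : Type*} [AddCommGroup A] {p : ℕ} [Fact p.Prime]

/-- `ker (T_p A → A[p^n]) = p^n T_p A`: an element of the Tate module whose `n`-th component
vanishes is divisible by `p ^ n` (iterate `TateModule.p_smul_div`). Private copy of
`TateModule.exists_eq_pow_smul_of_proj_eq_zero` of `KatzLatticeRationalTorsionProofs` (same
statement and proof; that module's imports — Frobenius density, isogeny quotients — are not wanted
here). Silverman, *AEC*, III.§7. [folklore] -/
private theorem proj_ker_eq_pow_smul_aux (n : ℕ) (a : TateModule A p) (h : proj p n a = 0) :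
    ∃ b : TateModule A p, a = ((p : ℤ_[p]) ^ n) • b := by
  induction n generalizing a with
  | zero => exact ⟨a, by rw [pow_zero, one_smul]⟩
  | succ n ih =>
    have h1 : proj p 1 a = 0 := by
      rw [← pow_smul_proj_self_add n 1 a, h, smul_zero]
    have hb : proj p n (div a h1) = 0 := by rw [proj_div]; exact h
    obtain ⟨c, hc⟩ := ih (div a h1) hb
    refine ⟨c, ?_⟩
    rw [← p_smul_div a h1, hc, smul_smul, pow_succ']

end Literature.NumberTheory.EllipticCurves.TateModule

namespace WeierstrassCurve

open Literature.NumberTheory.EllipticCurves Literature.NumberTheory.GaloisRepresentations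

variable (W : WeierstrassCurve ℚ) [W.IsElliptic] (p : ℕ) [Fact p.Prime]

/-- **Levelwise surjectivity ⟹ (im).**  For an elliptic curve `E = W/ℚ` and a prime `p`, if the
mod-`p^n` representation `Γ_ℚ → Aut(E[p^n])` is onto for every `n` (i.e. `ρ_{E,p^∞}(Γ_ℚ) =
GL₂(ℤ_p)`), then there is `σ ∈ Γ_ℚ` acting trivially on all `p`-power roots of unity
(`σ ∈ G_{ℚ(μ_{p^∞})}`) such that `T_pE/(σ - 1)T_pE ≃ ℤ_p` as `ℤ_p`-modules — hypothesis (im) of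
Burungale–Castella–Skinner 2025 (= Kato 2004 Thm. 13.4 (3); Skinner 2016 §2.5 (b)).  `σ` is any
element acting on `T_pE` by `(1 1; 0 1)` in a `ℤ_p`-basis; see the module docstring for the proof.
[cite: BurungaleCastellaSkinner2025, hypothesis (im) and Rem. 1.1.3 (i) (p. 2); Skinner2016PacificMC, §2.5 (a), (b)] -/
theorem exists_quotient_range_galoisRepTate_sub_one_equiv_of_forall_surjective
    (hsurj : ∀ n : ℕ, W.HasSurjectiveModNGaloisRep (p ^ n : ℕ)) :
    ∃ σ : absoluteGaloisGroup ℚ,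
      (∀ (n : ℕ) (t : AlgebraicClosure ℚ), t ^ p ^ n = 1 → σ • t = t) ∧
        Nonempty (((W.tateModule p) ⧸ LinearMap.range (W.galoisRepTate p σ - 1)) ≃ₗ[ℤ_[p]] ℤ_[p]) := by
  have hp : p.Prime := Fact.out
  have hp0 : (p : ℚ) ≠ 0 := Nat.cast_ne_zero.mpr hp.ne_zero
  haveI : NeZero (p : ℚ) := ⟨hp0⟩
  -- a `ℤ_p`-basis `b` of `T = T_pE`
  haveI : Module.Free ℤ_[p] (W.tateModule p) := module_free_tateModule_holds W p
  haveI : Module.Finite ℤ_[p] (W.tateModule p) := module_finite_tateModule_holds W p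
  set T := W.tateModule p
  let b : Module.Basis (Fin 2) ℤ_[p] T :=
    Module.finBasisOfFinrankEq ℤ_[p] T (finrank_tateModule_eq_two_holds W p hp0)
  -- `N t = b₁^*(t) • b₀`, `U = 1 + N`, `V = 1 - N`
  set N : T →ₗ[ℤ_[p]] T := (b.coord 1).smulRight (b 0) with hN
  have hN_apply : ∀ t : T, N t = (b.coord 1 t) • b 0 := fun t => rfl
  have hc10 : b.coord 1 (b 0) = 0 := by
    rw [Module.Basis.coord_apply, Module.Basis.repr_self, Finsupp.single_eq_of_ne (by decide)]
  have hc11 : b.coord 1 (b 1) = 1 := by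
    rw [Module.Basis.coord_apply, Module.Basis.repr_self, Finsupp.single_eq_same]
  have hN0 : N (b 0) = 0 := by
    rw [hN_apply, hc10, zero_smul]
  have hNN : ∀ t : T, N (N t) = 0 := by
    intro t
    rw [hN_apply t, map_smul, hN0, smul_zero]
  set U : T →ₗ[ℤ_[p]] T := LinearMap.id + N with hU
  set V : T →ₗ[ℤ_[p]] T := LinearMap.id - N with hV
  have hU_apply : ∀ t : T, U t = t + N t := fun t => rfl
  have hV_apply : ∀ t : T, V t = t - N t := fun t => rfl
  have hUV : ∀ t : T, U (V t) = t := by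
    intro t
    rw [hU_apply, hV_apply, map_sub, hNN, sub_zero, sub_add_cancel]
  have hVU : ∀ t : T, V (U t) = t := by
    intro t
    rw [hV_apply, hU_apply, map_add, hNN, add_zero, add_sub_cancel_right]
  -- the reduction maps `π n : T → E[p^n]`
  have hmem : ∀ (n : ℕ) (a : T), TateModule.proj p n a ∈ geomTorsion W (p ^ n : ℕ) :=
    fun n a => proj_tateModule_mem_geomTorsion W p n a
  have hπsurj : ∀ (n : ℕ) (P : geomTorsion W (p ^ n : ℕ)), ∃ a : T, TateModule.proj p n a = P := by
    intro n P
    exact proj_surjective_of_isAlgClosed_holds W p n P.2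
  -- `E[p^n]` is `p^n`-torsion
  have htors : ∀ (n : ℕ) (a : T), (p ^ n : ℕ) • (TateModule.proj p n a) = 0 :=
    fun n a => TateModule.pow_smul_proj n a
  -- `π_n (U a)` depends only on `π_n a`
  have hker : ∀ (n : ℕ) (L : T →ₗ[ℤ_[p]] T) (a a' : T),
      TateModule.proj p n a = TateModule.proj p n a' →
        TateModule.proj p n (L a) = TateModule.proj p n (L a') := by
    intro n L a a' h
    have h0 : TateModule.proj p n (a - a') = 0 := by rw [map_sub, h, sub_self]
    obtain ⟨c, hc⟩ := TateModule.proj_ker_eq_pow_smul_aux n (a - a') h0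
    have h1 : L a - L a' = ((p : ℤ_[p]) ^ n) • L c := by rw [← map_sub, hc, map_smul]
    rw [← sub_eq_zero, ← map_sub, h1, TateModule.proj_pow_smul, TateModule.pow_smul_proj]
  -- the induced map `φ n : E[p^n] → E[p^n]` (as a function first)
  have hφ : ∀ n : ℕ, ∃ φ : geomTorsion W (p ^ n : ℕ) ≃+ geomTorsion W (p ^ n : ℕ),
      ∀ a : T, (φ ⟨TateModule.proj p n a, hmem n a⟩ : geomPoints W) = TateModule.proj p n (U a) := by
    intro n
    -- choose lifts
    choose lift hlift using hπsurj n
    let f : geomTorsion W (p ^ n : ℕ) → geomTorsion W (p ^ n : ℕ) :=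
      fun P => ⟨TateModule.proj p n (U (lift P)), hmem n _⟩
    have hf : ∀ a : T, (f ⟨TateModule.proj p n a, hmem n a⟩ : geomPoints W) =
        TateModule.proj p n (U a) := by
      intro a
      exact hker n U _ _ (hlift _)
    have hf' : ∀ P : geomTorsion W (p ^ n : ℕ), (f P : geomPoints W) =
        TateModule.proj p n (U (lift P)) := fun P => rfl
    -- additive
    have hadd : ∀ P Q, f (P + Q) = f P + f Q := by
      intro P Q
      apply Subtype.ext
      have hPQ : TateModule.proj p n (lift P + lift Q) = ((P + Q : geomTorsion W (p ^ n : ℕ)) : geomPoints W) := by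
        rw [map_add, hlift, hlift]; rfl
      have := hker n U (lift (P + Q)) (lift P + lift Q) (by rw [hlift, hPQ])
      rw [hf', this, map_add, map_add]
      rfl
    let fh : geomTorsion W (p ^ n : ℕ) →+ geomTorsion W (p ^ n : ℕ) :=
      { toFun := f, map_zero' := by
          have h := hadd 0 0
          rw [add_zero] at h
          exact left_eq_add.mp h
        map_add' := hadd }
    -- inverse from `V`
    let g : geomTorsion W (p ^ n : ℕ) → geomTorsion W (p ^ n : ℕ) :=
      fun P => ⟨TateModule.proj p n (V (lift P)), hmem n _⟩
    have hfg : ∀ P, f (g P) = P := by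
      intro P
      apply Subtype.ext
      have h1 : (f (g P) : geomPoints W) = TateModule.proj p n (U (V (lift P))) :=
        hker n U _ _ (hlift _)
      rw [h1, hUV, hlift]
    have hgf : ∀ P, g (f P) = P := by
      intro P
      apply Subtype.ext
      have h1 : (g (f P) : geomPoints W) = TateModule.proj p n (V (U (lift P))) :=
        hker n V _ _ (hlift _)
      rw [h1, hVU, hlift]
    refine ⟨AddEquiv.mk ⟨f, g, hgf, hfg⟩ hadd, fun a => hf a⟩
  choose φ hφ using hφ
  -- Galois elements realising `φ n`
  have hσn : ∀ n : ℕ, ∃ σ : absoluteGaloisGroup ℚ,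
      ∀ a : T, σ • TateModule.proj p n a = TateModule.proj p n (U a) := by
    intro n
    obtain ⟨σ, hσ⟩ := hsurj n (Multiplicative.ofAdd (φ n))
    refine ⟨σ, fun a => ?_⟩
    have h1 : ((Multiplicative.toAdd (galoisRepTorsion W _ σ)) ⟨TateModule.proj p n a, hmem n a⟩ :
        geomPoints W) = σ • TateModule.proj p n a := rfl
    rw [← h1, hσ, toAdd_ofAdd, hφ]
  -- the closed sets `S n`
  let S : ℕ → Set (absoluteGaloisGroup ℚ) :=
    fun n => {σ | ∀ a : T, σ • TateModule.proj p n a = TateModule.proj p n (U a)}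
  haveI : ContinuousSMul (absoluteGaloisGroup ℚ) (geomPoints W) := continuousSMul_geomPoints' W
  have hSclosed : ∀ n, IsClosed (S n) := by
    intro n
    have : S n = ⋂ a : T, {σ | σ • TateModule.proj p n a = TateModule.proj p n (U a)} := by
      ext σ; simp [S]
    rw [this]
    refine isClosed_iInter fun a => ?_
    exact isClosed_eq (continuous_id.smul continuous_const) continuous_const
  have hSne : ∀ n, (S n).Nonempty := fun n => hσn n
  have hSmono : ∀ n, S (n + 1) ⊆ S n := by
    intro n σ hσ a
    have e1 : TateModule.proj p n a = p • TateModule.proj p (n + 1) a :=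
      (TateModule.smul_proj_succ n a).symm
    have e2 : TateModule.proj p n (U a) = p • TateModule.proj p (n + 1) (U a) :=
      (TateModule.smul_proj_succ n (U a)).symm
    rw [e1, e2, smul_comm, hσ a]
  haveI : CompactSpace (absoluteGaloisGroup ℚ) := inferInstance
  obtain ⟨σ, hσ⟩ := IsCompact.nonempty_iInter_of_sequence_nonempty_isCompact_isClosed S hSmono hSne
    (isClosed_univ.isCompact.of_isClosed_subset (hSclosed 0) (Set.subset_univ _)) hSclosed
  rw [Set.mem_iInter] at hσ
  -- `ρ_T(σ) = U`
  have hρ : ∀ a : T, σ • a = U a := by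
    intro a
    exact TateModule.ext fun n => by
      rw [TateModule.proj_smul_of_distribMulAction]; exact hσ n a
  have hρU : (W.galoisRepTate p σ : T →ₗ[ℤ_[p]] T) = U := by
    ext a; rw [galoisRepTate_apply_apply, hρ]
  refine ⟨σ, ?_, ?_⟩
  · -- `σ` fixes `μ_{p^∞}`: `χ_p(σ) = det U = 1`
    have hdetU : LinearMap.det U = 1 := by
      rw [← LinearMap.det_toMatrix b, Matrix.det_fin_two]
      simp only [LinearMap.toMatrix_apply, hU_apply, hN_apply, map_add, map_smul,
        Module.Basis.repr_self, Module.Basis.coord_apply, Finsupp.add_apply, Finsupp.smul_apply,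
        Finsupp.single_apply, smul_eq_mul]
      simp
    have hχ : GaloisRep.cyclotomicCharacter ℚ p σ = 1 := by
      apply Units.ext
      rw [Units.val_one, ← det_galoisRepTate_eq_cyclotomicCharacter W p hp0
        (fun n => exists_weilPairing_holds W _) σ, hρU, hdetU]
    intro n t ht
    have hspec := GaloisRep.cyclotomicCharacter_spec ℚ p (k := n) σ t ht
    rw [hχ] at hspec
    rw [hspec, Units.val_one, map_one]
    rcases Nat.eq_zero_or_pos n with rfl | hn
    · rw [pow_zero, pow_one] at ht
      rw [ht, one_pow]
    · haveI : Fact (1 < p ^ n) := ⟨Nat.one_lt_pow hn.ne' hp.one_lt⟩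
      rw [ZMod.val_one, pow_one]
  · -- `T/(U - 1)T ≃ ℤ_p`
    have hrange : LinearMap.range (W.galoisRepTate p σ - 1) = LinearMap.ker (b.coord 1) := by
      have hsub : (W.galoisRepTate p σ : T →ₗ[ℤ_[p]] T) - 1 = N := by
        rw [hρU, hU]; exact add_sub_cancel_left _ _
      rw [hsub]
      apply le_antisymm
      · rintro _ ⟨a, rfl⟩
        rw [LinearMap.mem_ker, hN_apply, map_smul, hc10, smul_zero]
      · intro a ha
        rw [LinearMap.mem_ker] at ha
        refine ⟨(b.coord 0 a) • b 1, ?_⟩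
        rw [hN_apply, map_smul, hc11, smul_eq_mul, mul_one]
        -- `a = (b₀^* a) • b₀` since `b₁^* a = 0`
        conv_rhs => rw [← b.sum_repr a]
        rw [Fin.sum_univ_two]
        have h1 : b.repr a 1 = 0 := ha
        rw [h1, zero_smul, add_zero, Module.Basis.coord_apply]
    have hsurj1 : Function.Surjective (b.coord 1) := by
      intro x
      refine ⟨x • b 1, ?_⟩
      rw [map_smul, hc11, smul_eq_mul, mul_one]
    exact ⟨(Submodule.quotEquivOfEq _ _ hrange).trans
      (LinearMap.quotKerEquivOfSurjective (b.coord 1) hsurj1)⟩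

/-- **`ρ̄_{E,p}` onto and `p ≥ 5` ⟹ (im)** (Serre).  For an elliptic curve `E = W/ℚ` and a prime
`p ≥ 5` at which the mod-`p` representation `ρ̄_{E,p} : Γ_ℚ → Aut(E[p])` is surjective, there is
`σ ∈ G_{ℚ(μ_{p^∞})}` with `T_pE/(σ - 1)T_pE ≃ ℤ_p`: by Serre's lifting lemma (a closed subgroup of
`SL₂(ℤ_p)` onto `SL₂(𝔽_p)` is everything for `p ≥ 5`; tree theorem
`serre_hasSurjectiveModNGaloisRep_pow_holds`) every `ρ̄_{E,p^n}` is onto, and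
`exists_quotient_range_galoisRepTate_sub_one_equiv_of_forall_surjective` applies.  This is the
implication "(im) ⇐ surj(p), `p ≥ 5`" used by the BSD rank-≤1 residual census (RESIDUAL-CASES
§a.0) for row C2 = BCS 2025 Cor. 1.3.1.
[cite: SerreAbelianLadic1968, Ch. IV §3.4 Lemma 3 (IV-23); BurungaleCastellaSkinner2025, Rem. 1.1.3 (i) (p. 2)] -/
theorem exists_quotient_range_galoisRepTate_sub_one_equiv_of_surjective (h5 : 5 ≤ p)
    (hsurj : W.HasSurjectiveModNGaloisRep p) :
    ∃ σ : absoluteGaloisGroup ℚ,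
      (∀ (n : ℕ) (t : AlgebraicClosure ℚ), t ^ p ^ n = 1 → σ • t = t) ∧
        Nonempty (((W.tateModule p) ⧸ LinearMap.range (W.galoisRepTate p σ - 1)) ≃ₗ[ℤ_[p]] ℤ_[p]) :=
  W.exists_quotient_range_galoisRepTate_sub_one_equiv_of_forall_surjective p
    (serre_hasSurjectiveModNGaloisRep_pow_holds W p h5 hsurj)

end WeierstrassCurve
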